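import Summits.ValiantsHypothesis.ValiantsHypothesis.Theorems.GrenetZeonDualUnipotentThreeHalvesLongMassCyclicGrading

/-!
# `GrenetZeon.DualUnipotentThreeHalves` (stmt-ValiantsHypothesis-24318), line `slow_core`, stub (c) `SlowCore.LongMassSlowLawInv`:
# THE POTENTIAL ROW — one certificate for flags, coarsenings, rings and helices: «raise slowly, crash rarely»

Unifies the two certificate mechanisms now in the tree — the FLAG / coarsening certificate (level functions the pencil never raises;
✓ `SlowCore.LevelCut`, `FlagCost`, `CoarseningLaw`) and the PERIODIC FREEZE of ✓ `…LongMassCyclicGrading` (supports on a directed cycle) — in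
one statement with two integer dials.  DATA: a potential `φ : Fin b → ℕ` bounded by `Φ`, a RISE BOUND `R` and a CRASH DEPTH `D` (`D + R ≥ 1`).
HYPOTHESIS (support shape only — no nilpotency, no flag, no irreducibility): every non-zero entry `N i j` (an arrow `j → i`) raises the
potential by at most `R`: `φ i ≤ φ j + R`.  CERTIFICATE: FREEZE the non-zero entries that do not crash (`φ j < φ i + D`), leave FREE the crashes
(`φ j ≥ φ i + D`).  WALK COUNT (★ `pow_lineSubst_degree_le_potential`): along a frozen direction `v`, every entry of `N(x + s v)^e` is `0` or has
`s`-degree `d` with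

  `(D + R)·d + φ i ≤ R·e + φ j`

(each free step costs `D` of potential and each step refunds at most `R`; the potential is `≥ 0`).  Hence ★★ `relCert_of_potential`:
`RelCert n b N (n·((R·(n − 1) + Φ)/(D + R)) + #{frozen non-zero entries})`.

Dials.  `R = 0` (the pencil never raises `φ`): window `Φ/D`, frozen = entries dropping `φ` by `< D` — the flag certificate and, with `φ` a block
level and `D ≥ 2`, the COARSENING certificate (`relCert_of_potential_flag`).  `R = 1`, `φ` = cyclic level, `D = Φ = L − 1`: the cyclic row
(window `⌈(n − 1)/L⌉`).  `R ≥ 1` in general: HELICAL supports (slow climbs, rare deep crashes) are cheap whenever crashes are deep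
(`D ≫ R·n/k`) and the non-crashing mass is `≤ c√n·b` — a (c)-violator's support admits NO potential with few shallow entries and deep crashes.

HONEST FRAMING.  Certificate mechanism (`--supports stmt-ValiantsHypothesis-24318`); not progress on the hard regime of the research stub (c)
`SlowCore.LongMassSlowLawInv`; closes no stub; S3, 24318, 8062 and `VP ≠ VNP` are NOT proved.  Def-free, no named-fact hypotheses, no sorry.
[folklore: potential-function bounds for weighted walks]
-/

set_option linter.dupNamespace false
set_option autoImplicit false

noncomputable section

namespace Summit.ValiantsHypothesis.ValiantsHypothesis.Theorems.GrenetZeon.PotentialRow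

open MvPolynomial Matrix
open scoped BigOperators
open Summit.ValiantsHypothesis.ValiantsHypothesis.Cruxes.TwoDimCoefficients.DimTwoCases (AffMat IsAffine)
open Summit.ValiantsHypothesis.ValiantsHypothesis.Theorems.GrenetZeon.RadicalSplit (lineSubst)
open Summit.ValiantsHypothesis.ValiantsHypothesis.Theorems.GrenetZeon.SlowCore
open Summit.ValiantsHypothesis.ValiantsHypothesis.Theorems.GrenetZeon.CyclicGrading
  (lineSubst_entry_eq_zero totalDegree_entry_eq_zero_of_linEntry totalDegree_entry_le_one)

variable {n b : ℕ}

/-! ## §1 The walk count with a potential -/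

/-- ★ **POTENTIAL WALK COUNT.**  If every non-zero entry `N i j` satisfies `φ i ≤ φ j + R`, and the direction `v` freezes every non-zero
entry with `φ j < φ i + D` (the non-crashing ones), then for every `e` and all `i j` the entry `(N(x + s v)^e)_{ij}` is `0` or has `s`-degree
`d` with `(D + R)·d + φ i ≤ R·e + φ j`. -/
theorem pow_lineSubst_degree_le_potential (N : AffMat n b) (hN : IsAffine N) (φ : Fin b → ℕ) (R D : ℕ)
    (hrise : ∀ i j, N i j ≠ 0 → φ i ≤ φ j + R)
    (x v : Fin n × Fin n → ℂ) (hv : ∀ i j, N i j ≠ 0 → φ j < φ i + D → linEntry N i j v = 0) :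
    ∀ e : ℕ, ∀ i j : Fin b, ((N.map (lineSubst x v)) ^ e) i j = 0 ∨
      (D + R) * (((N.map (lineSubst x v)) ^ e) i j).totalDegree + φ i ≤ R * e + φ j := by
  classical
  set Q := N.map (lineSubst x v) with hQ
  intro e
  induction e with
  | zero =>
    intro i j
    by_cases hij : i = j
    · subst hij
      right
      rw [pow_zero, Matrix.one_apply_eq, ← C_1, totalDegree_C]
      omega
    · left
      rw [pow_zero, Matrix.one_apply_ne hij]
  | succ e ih =>
    intro i j
    have hterm : ∀ l : Fin b, (Q ^ e) i l * Q l j = 0 ∨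
        (D + R) * ((Q ^ e) i l * Q l j).totalDegree + φ i ≤ R * (e + 1) + φ j := by
      intro l
      by_cases hN0 : N l j = 0
      · left; rw [hQ, lineSubst_entry_eq_zero N x v hN0, mul_zero]
      rcases ih i l with h0 | hdeg
      · left; rw [h0, zero_mul]
      right
      have hmul : ((Q ^ e) i l * Q l j).totalDegree ≤ ((Q ^ e) i l).totalDegree + (Q l j).totalDegree := totalDegree_mul _ _
      have hlj := hrise l j hN0
      by_cases hcrash : φ j < φ l + D
      · -- non-crashing step: frozen, degree `0`, potential rises by `≤ R`
        have hfz : (Q l j).totalDegree = 0 := totalDegree_entry_eq_zero_of_linEntry N hN x v (hv l j hN0 hcrash)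
        rw [hfz, add_zero] at hmul
        have := Nat.mul_le_mul_left (D + R) hmul
        rw [Nat.mul_add] at *
        nlinarith [hdeg, this, hlj]
      · -- crash: free, degree `≤ 1`, potential drops by `≥ D`
        push Not at hcrash
        have h1 : (Q l j).totalDegree ≤ 1 := totalDegree_entry_le_one N hN x v l j
        have := Nat.mul_le_mul_left (D + R) (hmul.trans (Nat.add_le_add_left h1 _))
        rw [Nat.mul_add, Nat.mul_one] at this
        rw [Nat.mul_add] at *
        nlinarith [hdeg, this, hcrash]
    rw [pow_succ, Matrix.mul_apply]
    by_cases hall : ∀ l : Fin b, (Q ^ e) i l * Q l j = 0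
    · left; exact Finset.sum_eq_zero fun l _ => hall l
    · right
      push Not at hall
      obtain ⟨l₀, hl₀⟩ := hall
      have hB : φ i ≤ R * (e + 1) + φ j := by
        rcases hterm l₀ with h | h
        · exact absurd h hl₀
        · exact le_trans (Nat.le_add_left _ _) h
      rcases Nat.eq_zero_or_pos (D + R) with hDR | hDR
      · -- degenerate dials: the inequality is the bound on `φ i` alone
        rw [hDR, zero_mul, zero_add]; exact hB
      have hdeg : ∀ l : Fin b, ((Q ^ e) i l * Q l j).totalDegree ≤ (R * (e + 1) + φ j - φ i) / (D + R) := by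
        intro l
        rcases hterm l with h | h
        · rw [h, totalDegree_zero]; exact Nat.zero_le _
        · rw [Nat.le_div_iff_mul_le hDR, Nat.mul_comm]; omega
      have hsum : (∑ l, (Q ^ e) i l * Q l j).totalDegree ≤ (R * (e + 1) + φ j - φ i) / (D + R) :=
        (totalDegree_finsetSum _ _).trans (Finset.sup_le fun l _ => hdeg l)
      have := Nat.div_mul_le_self (R * (e + 1) + φ j - φ i) (D + R)
      have h2 := Nat.mul_le_mul_right (D + R) hsum
      rw [Nat.mul_comm] at h2
      omega

/-! ## §2 THE POTENTIAL ROW -/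

/-- ★★ **THE POTENTIAL ROW.**  An affine `b × b` pencil with a potential `φ ≤ Φ` that no non-zero entry raises by more than `R`
(`N i j ≠ 0 ⇒ φ i ≤ φ j + R`), and dials `D + R ≥ 1`, has the whole-pencil certificate `K = freezeSpace N F`, `F` = the non-zero entries that
drop `φ` by less than `D`, with window order `(R·(n − 1) + Φ)/(D + R)`; hence `RelCert n b N (n·((R·(n−1) + Φ)/(D + R)) + F.card)`.
No nilpotency or flag hypothesis. [folklore] -/
theorem relCert_of_potential (N : AffMat n b) (hN : IsAffine N) (φ : Fin b → ℕ) (Φ R D : ℕ) (hΦ : ∀ i, φ i ≤ Φ) (hDR : 0 < D + R)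
    (hrise : ∀ i j, N i j ≠ 0 → φ i ≤ φ j + R) :
    RelCert n b N (n * ((R * (n - 1) + Φ) / (D + R)) +
      (Finset.univ.filter fun ij : Fin b × Fin b => N ij.1 ij.2 ≠ 0 ∧ φ ij.2 < φ ij.1 + D).card) := by
  classical
  set F : Finset (Fin b × Fin b) := Finset.univ.filter fun ij : Fin b × Fin b => N ij.1 ij.2 ≠ 0 ∧ φ ij.2 < φ ij.1 + D with hF
  refine ⟨freezeSpace N F, (R * (n - 1) + Φ) / (D + R), ?_, ?_⟩
  · intro x v hv e he i j _ _
    have hfz : ∀ i j, N i j ≠ 0 → φ j < φ i + D → linEntry N i j v = 0 := fun i j hij hj =>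
      linEntry_eq_zero_of_mem_freezeSpace N F (by rw [hF, Finset.mem_filter]; exact ⟨Finset.mem_univ _, hij, hj⟩) hv
    rcases Nat.eq_zero_or_pos e with he0 | he0
    · subst he0
      rw [pow_zero, Matrix.one_apply]
      split_ifs
      · rw [← C_1, totalDegree_C]; exact Nat.zero_le _
      · rw [totalDegree_zero]; exact Nat.zero_le _
    rcases pow_lineSubst_degree_le_potential N hN φ R D hrise x v hfz e i j with h0 | hdeg
    · rw [h0, totalDegree_zero]; exact Nat.zero_le _
    · set d := (((N.map (lineSubst x v)) ^ e) i j).totalDegree with hd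
      have hj := hΦ j
      have h3 : (D + R) * d ≤ R * (n - 1) + Φ := by
        have hRe : R * e ≤ R * (n - 1) := Nat.mul_le_mul_left R he
        omega
      exact (Nat.le_div_iff_mul_le hDR).mpr (by rw [Nat.mul_comm]; exact h3)
  · have h := codim_freezeSpace_le N F
    omega

/-- ★ **FLAG DIAL `R = 0`** (the pencil never raises `φ`; coarsening at depth `D ≥ 1`): window `Φ/D`, frozen = non-zero entries dropping `φ` by
`< D`.  With `φ` a block level this is the parabolic / coarsening certificate of the flag files, here free of any level-cut bookkeeping. [folklore] -/
theorem relCert_of_potential_flag (N : AffMat n b) (hN : IsAffine N) (φ : Fin b → ℕ) (Φ D : ℕ) (hΦ : ∀ i, φ i ≤ Φ) (hD : 0 < D)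
    (hflag : ∀ i j, N i j ≠ 0 → φ i ≤ φ j) :
    RelCert n b N (n * (Φ / D) +
      (Finset.univ.filter fun ij : Fin b × Fin b => N ij.1 ij.2 ≠ 0 ∧ φ ij.2 < φ ij.1 + D).card) := by
  have h := relCert_of_potential N hN φ Φ 0 D hΦ (by omega) (fun i j hij => by have := hflag i j hij; omega)
  simpa using h

/-- ★ **CYCLIC DIAL `R = 1`, `D = Φ = L − 1`** (directed cycle of `L ≥ 1` levels; agrees with ✓ `CyclicGrading.relCert_of_cyclicSupport` up to the
description of the frozen set): window `(n − 1 + (L − 1))/L`. [folklore] -/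
theorem relCert_of_potential_cyclic (N : AffMat n b) (hN : IsAffine N) {L : ℕ} (lvl : Fin b → ℕ) (hlvl : ∀ i, lvl i < L)
    (hsupp : ∀ i j, N i j ≠ 0 → lvl i = lvl j + 1 ∨ (lvl j + 1 = L ∧ lvl i = 0)) :
    RelCert n b N (n * ((1 * (n - 1) + (L - 1)) / (L - 1 + 1)) +
      (Finset.univ.filter fun ij : Fin b × Fin b => N ij.1 ij.2 ≠ 0 ∧ lvl ij.2 < lvl ij.1 + (L - 1)).card) :=
  relCert_of_potential N hN lvl (L - 1) 1 (L - 1) (fun i => by have := hlvl i; omega) (by omega)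
    (fun i j hij => by rcases hsupp i j hij with h | ⟨h1, h2⟩ <;> omega)

end Summit.ValiantsHypothesis.ValiantsHypothesis.Theorems.GrenetZeon.PotentialRow

end
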